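import Summits.QuantumFields.YangMills.Theorems.InfiniteVolumeContinuumTemperedCurrenciesDefs
import Summits.QuantumFields.YangMills.Theorems.InfiniteVolumeContinuumOctaveInduction
import HarnessLib

/-!
# The two PINNED OCTAVE currencies D1 ∕ D2 of LINE «OctaveDoubling» on the leaf `HypercubicOSDataFromInfiniteVolume`
# (stmt-QuantumFields-19868) — Defs module (landing kit, part 2)

The registered skeleton `Cruxes/HypercubicOSDataFromInfiniteVolume/Lines/octave_doubling.lean` REV 2.1 (sha16 a67e571407d40d37,
planner `ym-idea-11` g19; critic idea-crit-9 verdict #98 PASS-WITH-PRICE light) has two load-bearing stubs whose statements were,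
until now, declared ONLY inside the crux workfile (not importable on the farm):

* **D1 `PinnedTopOctaveCeiling`** — the tempered on-axis mirror ceiling `|c_{q,k}(t)| ≤ (C/R⁴)²(ℓ₄/(Rs))^M` owed ONLY on the
  non-doublable octave(s) at the PINNED onset scale `s` (`κℓ₄ < Rs ≤ ℓ₄` for every fixed `κ ∈ (0,1]`, or the torus top octave
  `L < 8R+8`) [E-wall `n = 2`, one octave wide];
* **D2 `PinnedOctaveStep`** — UV-ward octave regularity strictly below the pinned scale: a bound `B` on `|c(t')|`,
  `t' ∈ [4R+2, L]`, gives `|c(t)| ≤ K·max(B, (C₀/R⁴)²)` on `t ∈ [2R+2, L]` for SOME β-uniform `K ≥ 1` [multiscale ∕ RG class].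

This file lands them CHARACTER FOR CHARACTER (skeleton lines 196–260) in the namespace of the landed currency module
`…HypercubicOSDataFromInfiniteVolume.TemperedCurrencies` (✓ `Theorems/InfiniteVolumeContinuumTemperedCurrenciesDefs.lean`, whose
`PinnedTemperedCeiling` = E_T is the statement D1 ∧ D2 reconstruct), together with the skeleton's §2b certificates, now proved
against the LANDED modules BY NAME:

* `pinnedTempered_of_octaves : PinnedTopOctaveCeiling → PinnedOctaveStep → PinnedTemperedCeiling` — the dyadic reduction
  (`ε₀ := min`, `ℓ₄ := min ℓ₄¹ ℓ₄²`, `κ := ℓ₄/(2ℓ₄¹)`, `M := max M₁ M₂` with `K ≤ 2^{M₂}`, `C := √max(C₁²(ℓ₄¹/ℓ₄)^{M₁}, K C₀²)`),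
  whose real-analysis core is the landed `InfiniteVolumeContinuum.OctaveInduction.octave_induction`;
* `pinnedTopOctave_of_tempered : PinnedTemperedCeiling → PinnedTopOctaveCeiling` (restriction; wuc certificate);
* `pinnedOctaveStep_of_axisMirror : AxisMirrorCeiling → PinnedOctaveStep` (`K = 1`; wuc certificate: D2 ⟸ item 26791).

So after this file the line's D-stubs can be worked, landed and consumed BY NAME (`theorem stub_pinnedOctaveStep : PinnedOctaveStep`
etc.), exactly as W ✓p781979, CAL ✓p782165 and E3T (`stub_temperedMomentBoundA`) were.

HONEST LABEL: two DEFINITIONS (open Props, VERBATIM from a critic-passed skeleton) and three implications between OPEN Props; nothing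
here proves D1, D2, a crux, a rung, the leaf 19868 or any summit; nothing about Bałaban's RG or Clay is asserted; the Yang–Mills mass
gap is NOT proved.  Prover seat `ymfull-r2a-prover-2` g0 (R590-ym item (14)), 2026-08-30.
-/

set_option autoImplicit false

noncomputable section

open scoped BigOperators
open MeasureTheory Filter Topology
open Literature.MathematicalPhysics.QuantumFieldTheory Literature.MathematicalPhysics.QuantumLattice
open Summit.QuantumFields.YangMills.Cruxes.OSLegsFromFemtoAndGap.DlrCollarTransfer (Q2 Q3 torusE plane)
open Summit.QuantumFields.YangMills.Theses.SquareRootCeilings (AxisMirrorCeiling)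
open Summit.QuantumFields.YangMills.Theorems.InfiniteVolumeContinuum.OctaveInduction (octave_induction)

namespace Summit.QuantumFields.YangMills.Cruxes.HypercubicOSDataFromInfiniteVolume.TemperedCurrencies

/-! ## §1 The two pinned octave currencies (skeleton `Lines/octave_doubling.lean` REV 2.1, lines 196–260, verbatim) -/

/-- **D1 `PinnedTopOctaveCeiling`** (REV 2 of `TopOctaveCeiling`: pinned test scale) — E_T's conclusion owed ONLY at
NON-DOUBLABLE scales: the top octave(s) below the pinned onset scale, `κ ℓ₄ < R s (≤ ℓ₄)` for every fixed `κ ∈ (0,1]`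
(constants `M, C, β₄` may depend on `κ`; `ℓ₄` is chosen first), or the top octave of the odd torus, `L < 8R + 8`
(finite-size twin).  Same antecedent, guard AND PIN as E_T.  `E_T ⇒ D1` (`pinnedTopOctave_of_tempered`); with D2 it gives
E_T back (`pinnedTempered_of_octaves`).  [E-wall n = 2 on ONE octave at the onset; the wall, narrowed] -/
def PinnedTopOctaveCeiling : Prop :=
  ∀ (G : Type) [Group G] [TopologicalSpace G] [IsTopologicalGroup G] [CompactSpace G],
    IsCompactSimpleLieGroup G → Nonempty (G ≃ₜ* Matrix.specialUnitaryGroup (Fin 2) ℂ) →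
    letI : MeasurableSpace G := borel G
    haveI : BorelSpace G := ⟨rfl⟩
    ∀ (r : LatticeRep G) (v f g h : SchwartzMap (EuclideanSpace ℝ (Fin 4)) ℝ) (Λ₅ : ℝ), ∃ ε₀ : ℝ, 0 < ε₀ ∧
      ∀ ε : ℝ, 0 < ε → ε ≤ ε₀ →
        (∃ β₅ : ℝ, ∀ β : ℝ, β₅ ≤ β → ∃ s : ℝ, 0 < s ∧ s ≤ 1 ∧
            (∀ L : ℕ, Λ₅ ≤ s * L → ε ≤ Q2 G r β L s (thetaTest 4 v) v) ∧
            (∀ L : ℕ, Λ₅ ≤ s * L → ε ≤ |Q3 G r β L s f g h|)) →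
        ∃ ℓ₄ : ℝ, 0 < ℓ₄ ∧ ∀ κ : ℝ, 0 < κ → κ ≤ 1 →
        ∃ (M : ℕ) (C β₄ : ℝ), 0 ≤ C ∧ ∀ β : ℝ, β₄ ≤ β → ∀ s : ℝ, 0 < s → s ≤ 1 →
          (∀ s' : ℝ, 2 * s ≤ s' → s' ≤ 1 →
            ¬ ((∀ L : ℕ, Λ₅ ≤ s' * L → ε ≤ Q2 G r β L s' (thetaTest 4 v) v) ∧
               (∀ L : ℕ, Λ₅ ≤ s' * L → ε ≤ |Q3 G r β L s' f g h|))) →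
          ((∀ L : ℕ, Λ₅ ≤ s * L → ε ≤ Q2 G r β L s (thetaTest 4 v) v) ∧
            (∀ L : ℕ, Λ₅ ≤ s * L → ε ≤ |Q3 G r β L s f g h|)) →
          ∀ (L : ℕ) (q : Fin 4 × Fin 4) (k : Fin 4) (R t : ℕ), q.1 < q.2 → 1 ≤ R → (R : ℝ) * s ≤ ℓ₄ →
            4 * R + 8 ≤ L → (κ * ℓ₄ < (R : ℝ) * s ∨ L < 8 * R + 8) → 2 * R + 2 ≤ t → t ≤ L →
            |torusE G r β L (fun U =>
                (plane G r q (fun i => if i = k then (t : ℤ) else 0) U -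
                    torusE G r β L (plane G r q (fun i => if i = k then (t : ℤ) else 0))) *
                  (plane G r q (fun _ => 0) U - torusE G r β L (plane G r q (fun _ => 0))))| ≤
              (C / (R : ℝ) ^ 4) ^ 2 * (ℓ₄ / ((R : ℝ) * s)) ^ M

/-- **D2 `PinnedOctaveStep`** (REV 2 of `MirrorOctaveStep`: pinned test scale) — ULTRAVIOLET-WARD OCTAVE REGULARITY of the
on-axis mirror covariance strictly below the pinned onset scale (`2Rs ≤ ℓ₄`) and inside the torus (`8R+8 ≤ L`): a bound `B`
on `|c(t')|` over the doubled octave `t' ∈ [4R+2, L]` gives `|c(t)| ≤ K · max(B, (C₀/R⁴)²)` on `t ∈ [2R+2, L]`, for SOME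
β-uniform `K ≥ 1`, `C₀ ≥ 0` — `R⁸c(R)` grows by at most a factor `K` per octave toward the UV unless it is below the
hyperscaling size `C₀²`.  `26791 ⇒ D2` with `K = 1` (`pinnedOctaveStep_of_axisMirror`).  [multiscale ∕ RG regularity;
measurable octave by octave] -/
def PinnedOctaveStep : Prop :=
  ∀ (G : Type) [Group G] [TopologicalSpace G] [IsTopologicalGroup G] [CompactSpace G],
    IsCompactSimpleLieGroup G → Nonempty (G ≃ₜ* Matrix.specialUnitaryGroup (Fin 2) ℂ) →
    letI : MeasurableSpace G := borel G
    haveI : BorelSpace G := ⟨rfl⟩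
    ∀ (r : LatticeRep G) (v f g h : SchwartzMap (EuclideanSpace ℝ (Fin 4)) ℝ) (Λ₅ : ℝ), ∃ ε₀ : ℝ, 0 < ε₀ ∧
      ∀ ε : ℝ, 0 < ε → ε ≤ ε₀ →
        (∃ β₅ : ℝ, ∀ β : ℝ, β₅ ≤ β → ∃ s : ℝ, 0 < s ∧ s ≤ 1 ∧
            (∀ L : ℕ, Λ₅ ≤ s * L → ε ≤ Q2 G r β L s (thetaTest 4 v) v) ∧
            (∀ L : ℕ, Λ₅ ≤ s * L → ε ≤ |Q3 G r β L s f g h|)) →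
        ∃ (K C₀ ℓ₄ β₄ : ℝ), 0 < ℓ₄ ∧ 1 ≤ K ∧ 0 ≤ C₀ ∧ ∀ β : ℝ, β₄ ≤ β → ∀ s : ℝ, 0 < s → s ≤ 1 →
          (∀ s' : ℝ, 2 * s ≤ s' → s' ≤ 1 →
            ¬ ((∀ L : ℕ, Λ₅ ≤ s' * L → ε ≤ Q2 G r β L s' (thetaTest 4 v) v) ∧
               (∀ L : ℕ, Λ₅ ≤ s' * L → ε ≤ |Q3 G r β L s' f g h|))) →
          ((∀ L : ℕ, Λ₅ ≤ s * L → ε ≤ Q2 G r β L s (thetaTest 4 v) v) ∧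
            (∀ L : ℕ, Λ₅ ≤ s * L → ε ≤ |Q3 G r β L s f g h|)) →
          ∀ (L : ℕ) (q : Fin 4 × Fin 4) (k : Fin 4) (R : ℕ) (B : ℝ), q.1 < q.2 → 1 ≤ R → 2 * (R : ℝ) * s ≤ ℓ₄ →
            8 * R + 8 ≤ L →
            (∀ t' : ℕ, 4 * R + 2 ≤ t' → t' ≤ L →
              |torusE G r β L (fun U =>
                (plane G r q (fun i => if i = k then (t' : ℤ) else 0) U -
                    torusE G r β L (plane G r q (fun i => if i = k then (t' : ℤ) else 0))) *
                  (plane G r q (fun _ => 0) U - torusE G r β L (plane G r q (fun _ => 0))))| ≤ B) →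
            ∀ t : ℕ, 2 * R + 2 ≤ t → t ≤ L →
            |torusE G r β L (fun U =>
                (plane G r q (fun i => if i = k then (t : ℤ) else 0) U -
                    torusE G r β L (plane G r q (fun i => if i = k then (t : ℤ) else 0))) *
                  (plane G r q (fun _ => 0) U - torusE G r β L (plane G r q (fun _ => 0))))| ≤
              K * max B ((C₀ / (R : ℝ) ^ 4) ^ 2)

/-! ## §2 The dyadic reduction and the wuc certificates (skeleton §2b, proved against the landed modules) -/

/-- **`D1 → D2 → E_T`** — the dyadic reduction of the sister line's load-bearing stub (REV 2, pinned), PROVED: `ε₀ := min`,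
`ℓ₄ := min ℓ₄¹ ℓ₄²`, `κ := ℓ₄/(2ℓ₄¹)`, `M := max M₁ M₂` with `K ≤ 2^{M₂}`, `C := √max(C₁²(ℓ₄¹/ℓ₄)^{M₁}, K C₀²)`,
`β₄ := max`. -/
theorem pinnedTempered_of_octaves (hD1 : PinnedTopOctaveCeiling) (hD2 : PinnedOctaveStep) :
    PinnedTemperedCeiling := by
  intro G _ _ _ _ hG hcl
  letI : MeasurableSpace G := borel G
  haveI : BorelSpace G := ⟨rfl⟩
  intro r v f g h' Λ₅
  obtain ⟨ε₁, hε₁, H1⟩ := hD1 G hG hcl r v f g h' Λ₅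
  obtain ⟨ε₂, hε₂, H2⟩ := hD2 G hG hcl r v f g h' Λ₅
  refine ⟨min ε₁ ε₂, lt_min hε₁ hε₂, fun ε hε hεε hfl => ?_⟩
  obtain ⟨ℓ₁, hℓ₁, H1'⟩ := H1 ε hε (hεε.trans (min_le_left _ _)) hfl
  obtain ⟨K, C₀, ℓ₂, β₂, hℓ₂, hK, hC₀, H2'⟩ := H2 ε hε (hεε.trans (min_le_right _ _)) hfl
  have hℓ : 0 < min ℓ₁ ℓ₂ := lt_min hℓ₁ hℓ₂
  have hκpos : 0 < min ℓ₁ ℓ₂ / (2 * ℓ₁) := by positivity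
  have hκle : min ℓ₁ ℓ₂ / (2 * ℓ₁) ≤ 1 := by
    rw [div_le_one (by positivity)]
    linarith [min_le_left ℓ₁ ℓ₂]
  obtain ⟨M₁, C₁, β₁, hC₁, H1''⟩ := H1' (min ℓ₁ ℓ₂ / (2 * ℓ₁)) hκpos hκle
  obtain ⟨M₂, hM₂⟩ := pow_unbounded_of_one_lt K (by norm_num : (1 : ℝ) < 2)
  set ℓ := min ℓ₁ ℓ₂ with hℓdef
  set M := max M₁ M₂ with hMdef
  set A := max (C₁ ^ 2 * (ℓ₁ / ℓ) ^ M₁) (K * C₀ ^ 2) with hAdef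
  have hA0 : 0 ≤ A := le_trans (by positivity) (le_max_right _ _)
  have hKM : K ≤ 2 ^ M := hM₂.le.trans (pow_le_pow_right₀ (by norm_num) (le_max_right _ _))
  refine ⟨M, Real.sqrt A, ℓ, max β₁ β₂, hℓ, Real.sqrt_nonneg _, ?_⟩
  intro β hβ s hs hs1 hsub hpin L q k R t hq hR hRs hL hRt htL
  have hmain := octave_induction (L := L) (κ := ℓ / (2 * ℓ₁))
    (c := fun t : ℕ => |torusE G r β L (fun U =>
        (plane G r q (fun i => if i = k then (t : ℤ) else 0) U -
            torusE G r β L (plane G r q (fun i => if i = k then (t : ℤ) else 0))) *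
          (plane G r q (fun _ => 0) U - torusE G r β L (plane G r q (fun _ => 0))))|)
    hs hℓ (min_le_left _ _) (min_le_right _ _) (le_of_eq (by field_simp)) hK hKM (le_max_left _ _)
    (le_max_left _ _) (le_max_right _ _)
    (fun R' t' h1 h2 h3 h4 h5 h6 =>
      H1'' β (le_of_max_le_left hβ) s hs hs1 hsub hpin L q k R' t' hq h1 h2 h3 h4 h5 h6)
    (fun R' B h1 h2 h3 hB t' h5 h6 =>
      H2' β (le_of_max_le_right hβ) s hs hs1 hsub hpin L q k R' B hq h1 h2 h3 hB t' h5 h6)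
    R t hR hRs hL hRt htL
  have hsq : (Real.sqrt A / (R : ℝ) ^ 4) ^ 2 = A / (R : ℝ) ^ 8 := by
    rw [div_pow, Real.sq_sqrt hA0, ← pow_mul]
  rw [hsq]
  exact hmain

/-- `E_T ⇒ D1` (restriction; same constants for every `κ`). [wuc certificate] -/
theorem pinnedTopOctave_of_tempered (hE : PinnedTemperedCeiling) : PinnedTopOctaveCeiling := by
  intro G _ _ _ _ hG hcl
  letI : MeasurableSpace G := borel G
  haveI : BorelSpace G := ⟨rfl⟩
  intro r v f g h' Λ₅
  obtain ⟨ε₀, hε₀, hh⟩ := hE G hG hcl r v f g h' Λ₅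
  refine ⟨ε₀, hε₀, fun ε hε hεε hfl => ?_⟩
  obtain ⟨M, C, ℓ₄, β₄, hℓ₄, hC, hmain⟩ := hh ε hε hεε hfl
  refine ⟨ℓ₄, hℓ₄, fun κ _ _ => ⟨M, C, β₄, hC, ?_⟩⟩
  intro β hβ s hs hs1 hsub hpin L q k R t hq hR hRs hL _hoct hRt htL
  exact hmain β hβ s hs hs1 hsub hpin L q k R t hq hR hRs hL hRt htL

/-- `26791 ⇒ D2` with `K = 1`, `C₀ = C` (the full-strength ceiling makes the step free; pin ignored). [wuc certificate] -/
theorem pinnedOctaveStep_of_axisMirror (hA : AxisMirrorCeiling) : PinnedOctaveStep := by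
  intro G _ _ _ _ hG hcl
  letI : MeasurableSpace G := borel G
  haveI : BorelSpace G := ⟨rfl⟩
  intro r v f g h' Λ₅
  obtain ⟨ε₀, hε₀, hh⟩ := hA G hG hcl r v f g h' Λ₅
  refine ⟨ε₀, hε₀, fun ε hε hεε hfl => ?_⟩
  obtain ⟨C, ℓ₄, β₄, hℓ₄, hC, hmain⟩ := hh ε hε hεε hfl
  refine ⟨1, C, ℓ₄, β₄, hℓ₄, le_rfl, hC, ?_⟩
  intro β hβ s hs hs1 hsub _hpin L q k R B hq hR h2Rs h8 _hB t hRt htL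
  have hRs : (R : ℝ) * s ≤ ℓ₄ := by nlinarith [show (0 : ℝ) ≤ (R : ℝ) * s by positivity]
  have := hmain β hβ s hs hs1 hsub L q k R t hq hR hRs (by omega) hRt htL
  rw [one_mul]
  exact this.trans (le_max_right _ _)

end Summit.QuantumFields.YangMills.Cruxes.HypercubicOSDataFromInfiniteVolume.TemperedCurrencies

end
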